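import Summits.Ventures.HodgeRepro2.HeckeSlashDoubleCoset

/-!
# HeckeLinear — linearity of the Hecke operators on functions, and their dependence on ball values only
(p2 annex row 166)

Cell pub-hodge-repro2, Tier 5 kernel annex (seat p2, Shimura-data / Hecke side). Proof lane (no new definition).
§8(d): uses an L-value-free non-vanishing device: NO.

`T_δ f = Σ_q f∥_k(δ r_q)` (row 114) is a finite sum of slash operators, hence (`hecke_add`, `hecke_smul`,
`hecke_sub`, `hecke_neg`, `hecke_zero`) additive, homogeneous, and — for `δ ∈ U(H)(K)` — reads `f` only on the
ball (`hecke_congr`: each term is a slash by an element of `U(2,1)`, row 87's `slash_congr`). Used by row 163's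
ball-level Atkin–Lehner splitting.

No `sorry`; `#print axioms` ⊆ {propext, Classical.choice, Quot.sound}.
-/

namespace Summit.Ventures.HodgeRepro2.ShimuraData

variable {K : Type*} [Field K]

/-- `T_δ` is additive on functions. -/
theorem hecke_add (S : Subgroup (GL (Fin 3) K)) (δ : GL (Fin 3) K) (τ₁ : K →+* ℂ) (Q : Matrix (Fin 3) (Fin 3) ℂ)
    (k : ℕ) [Fintype (S ⧸ (heckeSubgroup S δ).subgroupOf S)] (f g : (Fin 2 → ℂ) → ℂ) :
    hecke S δ τ₁ Q k (f + g) = hecke S δ τ₁ Q k f + hecke S δ τ₁ Q k g := by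
  ext z
  simp only [hecke, slash_add, Pi.add_apply, Finset.sum_add_distrib]

/-- `T_δ` commutes with scalars on functions. -/
theorem hecke_smul (S : Subgroup (GL (Fin 3) K)) (δ : GL (Fin 3) K) (τ₁ : K →+* ℂ) (Q : Matrix (Fin 3) (Fin 3) ℂ)
    (k : ℕ) [Fintype (S ⧸ (heckeSubgroup S δ).subgroupOf S)] (c : ℂ) (f : (Fin 2 → ℂ) → ℂ) :
    hecke S δ τ₁ Q k (c • f) = c • hecke S δ τ₁ Q k f := by
  ext z
  simp only [hecke, slash_smul, Pi.smul_apply, Finset.smul_sum]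

/-- `T_δ` respects subtraction on functions. -/
theorem hecke_sub (S : Subgroup (GL (Fin 3) K)) (δ : GL (Fin 3) K) (τ₁ : K →+* ℂ) (Q : Matrix (Fin 3) (Fin 3) ℂ)
    (k : ℕ) [Fintype (S ⧸ (heckeSubgroup S δ).subgroupOf S)] (f g : (Fin 2 → ℂ) → ℂ) :
    hecke S δ τ₁ Q k (f - g) = hecke S δ τ₁ Q k f - hecke S δ τ₁ Q k g := by
  rw [sub_eq_add_neg, sub_eq_add_neg, hecke_add, ← neg_one_smul ℂ g, hecke_smul, neg_one_smul]

/-- `T_δ (−f) = −T_δ f`. -/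
theorem hecke_neg (S : Subgroup (GL (Fin 3) K)) (δ : GL (Fin 3) K) (τ₁ : K →+* ℂ) (Q : Matrix (Fin 3) (Fin 3) ℂ)
    (k : ℕ) [Fintype (S ⧸ (heckeSubgroup S δ).subgroupOf S)] (f : (Fin 2 → ℂ) → ℂ) :
    hecke S δ τ₁ Q k (-f) = -hecke S δ τ₁ Q k f := by
  rw [← neg_one_smul ℂ f, hecke_smul, neg_one_smul]

/-- `T_δ 0 = 0`. -/
theorem hecke_zero (S : Subgroup (GL (Fin 3) K)) (δ : GL (Fin 3) K) (τ₁ : K →+* ℂ) (Q : Matrix (Fin 3) (Fin 3) ℂ)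
    (k : ℕ) [Fintype (S ⧸ (heckeSubgroup S δ).subgroupOf S)] :
    hecke S δ τ₁ Q k 0 = 0 := by
  have h := hecke_smul S δ τ₁ Q k (0 : ℂ) (0 : (Fin 2 → ℂ) → ℂ)
  rwa [zero_smul, zero_smul] at h

/-- `T_δ f` on the ball depends only on the values of `f` on the ball (`δ ∈ U(H)(K)`, each term a slash by an
element of `U(2,1)`). -/
theorem hecke_congr [NumberField K] [NumberField.IsCMField K] {τ₁ : K →+* ℂ} {H : Matrix (Fin 3) (Fin 3) K}
    {Q : Matrix (Fin 3) (Fin 3) ℂ} (hQ : IsFrame K τ₁ H Q) {S : Subgroup (GL (Fin 3) K)}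
    (hS : (S : Set (GL (Fin 3) K)) ⊆ unitaryGroup K H) {δ : GL (Fin 3) K} (hδ : δ ∈ unitaryGroup K H)
    [Fintype (S ⧸ (heckeSubgroup S δ).subgroupOf S)] {k : ℕ} {f g : (Fin 2 → ℂ) → ℂ}
    (hfg : ∀ w ∈ ball₂, f w = g w) {z : Fin 2 → ℂ} (hz : z ∈ ball₂) :
    hecke S δ τ₁ Q k f z = hecke S δ τ₁ Q k g z := by
  unfold hecke
  refine Finset.sum_congr rfl (fun q _ => ?_)
  exact slash_congr (hQ.isInU21_realEmbedding (mul_mem hδ (hS (heckeRep S δ q).2))) hfg hz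

end Summit.Ventures.HodgeRepro2.ShimuraData
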